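/-
Copyright (c) 2026 the pub-hodgecm-mathlib formalisation cell (harness21).  Prover seat hodgecm-mathlib-LH4-p07 (g9), req620 Track A «(D-RAM) FOUR-FRAME» squad
(STAGE-1b, row-(2) lineage; dealer LH4-plan (g13) WORD #58 RULING A ∕ #59: owner of the two-literal census law of `lev_{a,m}`, hand (T5-P-coneΔ)-RamK), 2026-09-04.
-/
import Summits.HodgeConjecture.HodgeConjecture.Theorems.F0P3cDyRamToricCensusSumRamK   -- ★ p857635 (LH4-p04 (g4)): T5s `toricCensusSum_ramK` (abstract tables, type RamK)
import HarnessLib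

/-!
# Crux `H413`, line LH4 «(D-RAM) FOUR-FRAME» — STAGE-1b, row (2): (T5-P-coneΔ-R2)-RamK «THE T5s WELD WITH A DIAGONAL CUTOFF: ★ WELD MINUS THE CUT TOP BAND»
# `ε·Σ_{j ≤ jl} Σ_a q^a·[j + a ≤ C]·(vP − vM) = q^m(2[(jl−d)∕2+1]_q − 2[d−d%2]_q) − 2·Σ_{a ∈ cut band} q^{a + ⌊jl∕2⌋}`,  `jl ≤ C`

Cell `hodgecm-mathlib` (D-0151), FLOOR 0, crux item H413 = `stmt-HodgeConjecture-24833`, route of record `HCCMUnconditional`; squad F0∕P3c∕LH4; lane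
`--supports stmt-HodgeConjecture-24833 --as helper` (count-neutral; pays NO tier-0 row).  THEOREMS ONLY (no `def`, no instance, no notation, no `sorry`, default heartbeats).
OWNER'S ORGAN №2 for the END `levels_typeTwo_censusLaw` (= `hLaw` of ★ p859606; scope `F0/P3c/LH4/LH4-p07/g9/SCOPE-T5P-cone.v1.LH4p07g9.md` + the 11:18Z regime note).

THE OBJECT.  By ★ p859713 (T5-P-cut) the `G`-side census of a template piece `lev_{a′,b′}` at one literal is, in the tokens `(m₁, jl₁) = (m − a′, jl − a′)` of its depth multiplier
`μ₁`, the UNIT-type one-multiplier order form with the rows capped at `J′` and the cone cells capped on the diagonal `j + b ≤ m₁ + jl₁ − D`, `D = b′ − 2a′`.  Near `1` the row cap is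
idle (`J′ = jl₁`) and `D ≤ m₁`, so the census DIFFERENCE of the two literals is ★ T5s's double sum `Σ_j Σ_a q^a (vP − vM)` (LH4-p04 (g4) `toricCensusSum_ramK`: abstract tables
`nP nM vP vM` under `hnP hnM hvGen hvOff hvTop`) with ONE extra indicator `[j + a ≤ C]`, `C ≥ jl`.  THIS FILE evaluates that cut sum from ★ T5s WITHOUT reopening its proof:
* §1 `cut_cell_diff_eq` — beyond the cutoff (`C < j + a`, `m ≤ jl ≤ C`) a cell is never generic: `vP − vM = ε·2q^{j − (j+a−m+1)∕2}` on an ALIVE FAR TOP cell (`j + m = jl + a`,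
  `2j + d ≤ 2jl + 1`, `m + 2d < j + a + 2`) and `0` otherwise (★ `hvOff` ∕ `hvTop` only);
* §2 `sum_cut_part_eq` — the cut part is ONE geometric block on the top diagonal: `ε·Σ_j Σ_a q^a·[C < j + a]·(vP − vM) = 2·Σ_{a ∈ band} q^{a + ⌊jl∕2⌋}`, band = the columns
  `a ≤ m` whose top cell is cut, far and alive (`C + m < jl + 2a`, `2m + 2d < jl + 2a + 2`, `2a + d ≤ 2m + 1`; the exponent `a + (j − (j+a−m+1)∕2) = a + ⌊jl∕2⌋` at `j = jl + a − m`
  holds in BOTH parities, no `hjl`∕`hpar` needed);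
* §3 **`toricCensusSum_ramK_cut`** — ★ T5s's binders VERBATIM + `(C) (hC : jl ≤ C)`: `ε·Σ_j Σ_a q^a·[j + a ≤ C]·(vP − vM) = q^m(2Σ_{i<(jl−d)∕2+1} q^i − 2Σ_{i<d−d%2} q^i) −
  2·Σ_{a ∈ band} q^{a + ⌊jl∕2⌋}` (★ T5s − §2);  §4 `toricCensusSum_ramK_cut_Ioc` — under `m + 2d ≤ C + 2` (the far condition is implied; near `1`: `jl₁ ≥ D + 2d − 2`) the band
  is the interval `a ∈ Ioc ((C + m − jl)∕2) ((2m + 1 − d)∕2)`;  `C ≥ m + jl` (no top cell cut, regime (R0)) gives back ★ T5s.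
READING.  At shifted tokens the level piece's two-literal census difference on type RamK is the unit's (`q^{m₁}(2[(jl₁−d)∕2+1]_q − 2[d−d%2]_q)`, ★) MINUS the doubled top band
`2q^{⌊jl₁∕2⌋}Σ_{m₁ − D∕2 < a ≤ m₁ − (d−1)∕2} q^a` that the square level `b′` cuts off — the only new arithmetic of the level-piece weld (scope (R2)); types U ∕ RamM: LH4-p08 (g8) ∕ tbd.
HONEST LABEL.  Count-neutral finite-sum bookkeeping over ℚ on ABSTRACT tables; nothing printed is asserted; no census law is stated; `HC_CM` is proved only modulo the 7 printed citations
(2 remaining named inputs: hLiu418 = `stmt-HodgeConjecture-24832`, h413 = `stmt-HodgeConjecture-24833`) until rung 0 closes.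

## References
* [Kottwitz1986BaseChangeUnits] R. E. Kottwitz, *Base change for unit elements of Hecke algebras*, Compositio Math. 60 (1986): §1 pp. 240–241.
* [Rogawski1990] J. D. Rogawski, *Automorphic Representations of Unitary Groups in Three Variables*, Ann. of Math. Stud. 123 (1990): §4.9 Prop. 4.9.1 (b) p. 55, Lemma 4.9.3 p. 56.
* [Flicker1998UnitaryFL] Y. Z. Flicker, *Elementary proof of the fundamental lemma for a unitary group*, Canad. J. Math. 50 (1998): Prop. 7 p. 84 (the level tables).
-/

set_option autoImplicit false

namespace Summit.HodgeConjecture.HodgeConjecture.Cruxes.H413.F0P3cDyRamToricCensusSumRamKCut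

open Finset
open Summit.HodgeConjecture.HodgeConjecture.Cruxes.H413.F0P3cDyRamToricCensusSumRamK (toricCensusSum_ramK)

/-! ## §1 A cut cell is an alive far top cell or empty -/

/-- **A CUT CELL IS AN ALIVE FAR TOP CELL OR EMPTY.**  In the T5s-RamK table frame (`m ≤ jl ≤ C`), a cell `(j, a)` beyond the diagonal cutoff (`C < j + a`) is never generic; by
★ `hvOff`∕`hvTop`, `vP − vM = ε·2·q^{j − (j+a−m+1)∕2}` on an alive far top cell (`j + m = jl + a`, `2j + d ≤ 2jl + 1`, `m + 2d < j + a + 2`) and `0` otherwise (the near top cells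
carry the same value on both sides). [cite: Flicker1998UnitaryFL, Prop. 7 p. 84] [cite: Rogawski1990, §4.9 Lemma 4.9.3 p. 56] -/
theorem cut_cell_diff_eq (x ε : ℚ) (hε : ε = 1 ∨ ε = -1) {d jl m C : ℕ} (hm : m ≤ jl) (hC : jl ≤ C) (vP vM : ℕ → ℕ → ℚ)
    (hvOff : ∀ j a, ¬ (a ≤ m ∧ (j + a ≤ m ∨ (2 * a ≤ m ∧ j + a ≤ jl))) → j + m ≠ jl + a → vP j a = 0 ∧ vM j a = 0)
    (hvTop : ∀ j a, ¬ (a ≤ m ∧ (j + a ≤ m ∨ (2 * a ≤ m ∧ j + a ≤ jl))) → j + m = jl + a →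
      (vP j a = if 2 * j + d ≤ 2 * jl + 1 ∧ (j + a + 2 ≤ m + 2 * d ∨ ε = 1) then (if j + a + 2 ≤ m + 2 * d then 1 else 2) * x ^ (j - (j + a - m + 1) / 2) else 0) ∧
      (vM j a = if 2 * j + d ≤ 2 * jl + 1 ∧ (j + a + 2 ≤ m + 2 * d ∨ ε = -1) then (if j + a + 2 ≤ m + 2 * d then 1 else 2) * x ^ (j - (j + a - m + 1) / 2) else 0))
    {j a : ℕ} (hcut : C < j + a) :
    vP j a - vM j a = if j + m = jl + a ∧ 2 * j + d ≤ 2 * jl + 1 ∧ m + 2 * d < j + a + 2 then ε * (2 * x ^ (j - (j + a - m + 1) / 2)) else 0 := by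
  have hng : ¬ (a ≤ m ∧ (j + a ≤ m ∨ (2 * a ≤ m ∧ j + a ≤ jl))) := by omega
  by_cases htop : j + m = jl + a
  · obtain ⟨hP, hM⟩ := hvTop j a hng htop
    rw [hP, hM]
    by_cases halive : 2 * j + d ≤ 2 * jl + 1
    · by_cases hfar : m + 2 * d < j + a + 2
      · have hnn : ¬ j + a + 2 ≤ m + 2 * d := by omega
        rcases hε with rfl | rfl <;> norm_num [hnn, halive, htop, hfar]
      · have hnear : j + a + 2 ≤ m + 2 * d := by omega
        norm_num [halive, hnear, hfar, htop]
    · norm_num [halive]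
  · obtain ⟨hP, hM⟩ := hvOff j a hng htop
    norm_num [hP, hM, htop]

/-! ## §2 The cut part is one geometric block on the top diagonal -/

/-- **THE CUT PART IS ONE GEOMETRIC BLOCK ON THE TOP DIAGONAL**: `ε·Σ_{j ≤ jl} Σ_{a ≤ jl+1} x^a·[C < j + a]·(vP − vM) = 2·Σ_{a ∈ band} x^{a + ⌊jl∕2⌋}`, band = the columns
`a ≤ m` whose top cell `j = jl + a − m` is cut, far and alive: `C + m < jl + 2a ∧ 2m + 2d < jl + 2a + 2 ∧ 2a + d ≤ 2m + 1` (exponent `a + (j − (j+a−m+1)∕2) = a + ⌊jl∕2⌋` in both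
parities). [cite: Kottwitz1986BaseChangeUnits, §1 pp. 240–241] [cite: Flicker1998UnitaryFL, Prop. 7 p. 84] -/
theorem sum_cut_part_eq (x ε : ℚ) (hε : ε = 1 ∨ ε = -1) {d jl m C : ℕ} (hm : m ≤ jl) (hC : jl ≤ C) (vP vM : ℕ → ℕ → ℚ)
    (hvOff : ∀ j a, ¬ (a ≤ m ∧ (j + a ≤ m ∨ (2 * a ≤ m ∧ j + a ≤ jl))) → j + m ≠ jl + a → vP j a = 0 ∧ vM j a = 0)
    (hvTop : ∀ j a, ¬ (a ≤ m ∧ (j + a ≤ m ∨ (2 * a ≤ m ∧ j + a ≤ jl))) → j + m = jl + a →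
      (vP j a = if 2 * j + d ≤ 2 * jl + 1 ∧ (j + a + 2 ≤ m + 2 * d ∨ ε = 1) then (if j + a + 2 ≤ m + 2 * d then 1 else 2) * x ^ (j - (j + a - m + 1) / 2) else 0) ∧
      (vM j a = if 2 * j + d ≤ 2 * jl + 1 ∧ (j + a + 2 ≤ m + 2 * d ∨ ε = -1) then (if j + a + 2 ≤ m + 2 * d then 1 else 2) * x ^ (j - (j + a - m + 1) / 2) else 0)) :
    ε * ∑ j ∈ range (jl + 1), ∑ a ∈ range (jl + 2), x ^ a * (if C < j + a then vP j a - vM j a else 0) =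
      2 * ∑ a ∈ (range (jl + 2)).filter (fun a => a ≤ m ∧ C + m < jl + 2 * a ∧ 2 * m + 2 * d < jl + 2 * a + 2 ∧ 2 * a + d ≤ 2 * m + 1), x ^ (a + jl / 2) := by
  have hεε : ε * ε = 1 := by rcases hε with rfl | rfl <;> norm_num
  rw [Finset.sum_comm, Finset.mul_sum, Finset.sum_filter, Finset.mul_sum]
  refine Finset.sum_congr rfl fun a _ => ?_
  by_cases ham : a ≤ m
  · -- column `a ≤ m`: only the top cell `j = jl + a - m` can survive the cut
    rw [Finset.sum_eq_single_of_mem (jl + a - m) (by rw [Finset.mem_range]; omega) (fun j hj hne => ?_)]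
    · by_cases hcut : C < jl + a - m + a
      · rw [if_pos hcut, cut_cell_diff_eq x ε hε hm hC vP vM hvOff hvTop hcut]
        by_cases hP : a ≤ m ∧ C + m < jl + 2 * a ∧ 2 * m + 2 * d < jl + 2 * a + 2 ∧ 2 * a + d ≤ 2 * m + 1
        · have h1 : jl + a - m + m = jl + a ∧ 2 * (jl + a - m) + d ≤ 2 * jl + 1 ∧ m + 2 * d < jl + a - m + a + 2 := by omega
          have hexp : a + (jl + a - m - (jl + a - m + a - m + 1) / 2) = a + jl / 2 := by omega
          rw [if_pos h1, if_pos hP, ← hexp, pow_add]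
          linear_combination (2 * x ^ a * x ^ (jl + a - m - (jl + a - m + a - m + 1) / 2)) * hεε
        · have h1 : ¬ (jl + a - m + m = jl + a ∧ 2 * (jl + a - m) + d ≤ 2 * jl + 1 ∧ m + 2 * d < jl + a - m + a + 2) := by omega
          rw [if_neg h1, if_neg hP, mul_zero, mul_zero, mul_zero]
      · have hP : ¬ (a ≤ m ∧ C + m < jl + 2 * a ∧ 2 * m + 2 * d < jl + 2 * a + 2 ∧ 2 * a + d ≤ 2 * m + 1) := by omega
        rw [if_neg hcut, if_neg hP, mul_zero, mul_zero, mul_zero]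
    · -- any other row of the column vanishes under the cut
      by_cases hcut : C < j + a
      · rw [if_pos hcut, cut_cell_diff_eq x ε hε hm hC vP vM hvOff hvTop hcut, if_neg (fun h => hne (by omega)), mul_zero]
      · rw [if_neg hcut, mul_zero]
  · -- column `a > m`: its top row lies beyond `jl`; the whole column vanishes under the cut
    have hP : ¬ (a ≤ m ∧ C + m < jl + 2 * a ∧ 2 * m + 2 * d < jl + 2 * a + 2 ∧ 2 * a + d ≤ 2 * m + 1) := fun h => ham h.1
    rw [if_neg hP, mul_zero, Finset.sum_eq_zero fun j hj => ?_, mul_zero]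
    by_cases hcut : C < j + a
    · rw [Finset.mem_range] at hj
      rw [if_pos hcut, cut_cell_diff_eq x ε hε hm hC vP vM hvOff hvTop hcut, if_neg (fun h => by omega), mul_zero]
    · rw [if_neg hcut, mul_zero]

/-! ## §3 The T5s weld with a diagonal cutoff -/

/-- **(T5-P-coneΔ-R2)-RamK: THE T5s WELD WITH A DIAGONAL CUTOFF.**  ★ T5s `toricCensusSum_ramK`'s binders VERBATIM (LH4-p04 (g4)) plus a cutoff constant `C` with `jl ≤ C`:
`ε·Σ_{j ≤ jl} Σ_{a ≤ jl+1} q^a·[j + a ≤ C]·(vP − vM) = q^m·(2Σ_{i<(jl−d)∕2+1} q^i − 2Σ_{i<d−d%2} q^i) − 2·Σ_{a ∈ band(C)} q^{a + ⌊jl∕2⌋}` — ★ T5s minus §2.  At the shifted tokens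
`(m₁, jl₁)` of a template piece and `C = m₁ + jl₁ − (b′ − 2a′)` this is the type-RamK two-literal census difference of `lev_{a′,b′}` near `1` (scope (R2)).
[cite: Kottwitz1986BaseChangeUnits, §1 pp. 240–241] [cite: Rogawski1990, §4.9 Prop. 4.9.1 (b) p. 55, Lemma 4.9.3 p. 56] [cite: Flicker1998UnitaryFL, Prop. 7 p. 84] -/
theorem toricCensusSum_ramK_cut (q : ℕ) {d jl m : ℕ} (ε : ℚ) (hq : 2 ≤ q) (hd : 2 ≤ d) (hjl : jl % 2 = d % 2) (hjlS : 3 * d ≤ jl + 2 + 2 * (d % 2))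
    (hpar : m % 2 = d % 2) (hmS : d - d % 2 ≤ m + 1) (hm : m ≤ jl) (hε : ε = 1 ∨ (ε = -1 ∧ jl + 2 ≤ m + 2 * d))
    (nP nM vP vM : ℕ → ℕ → ℚ)
    (hnP : ∀ j a, nP j a = ((if j = 0 then (if a = 0 then 1 else 0) else if j < a ∨ (j - a) % 2 = 1 then 0
      else if a = j then (if 2 ≤ d then q ^ j else (q - 1) * q ^ (j - 1)) else if a = 0 then (if 2 * d ≤ j + 1 then 2 else 1) * q ^ (j / 2)
      else if j - a + 2 < 2 * d then (q - 1) * q ^ (j - 1 - (j - a) / 2) else if j - a + 2 = 2 * d then (q - 2) * q ^ (j - d)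
      else 2 * (q - 1) * q ^ (j - 1 - (j - a) / 2) : ℕ) : ℚ))
    (hnM : ∀ j a, nM j a = ((if j = 0 then (if a = 0 then 1 else 0) else if j < a ∨ (j - a) % 2 = 1 then 0
      else if a = j then (if 2 ≤ d then q ^ j else (q + 1) * q ^ (j - 1)) else if a = 0 then (if j + 2 ≤ 2 * d then q ^ (j / 2) else 0)
      else if j - a + 2 < 2 * d then (q - 1) * q ^ (j - 1 - (j - a) / 2) else if j - a + 2 = 2 * d then q ^ (j - d + 1) else 0 : ℕ) : ℚ))
    (hvGen : ∀ j a, (a ≤ m ∧ (j + a ≤ m ∨ (2 * a ≤ m ∧ j + a ≤ jl))) → vP j a = nP j a ∧ vM j a = nM j a)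
    (hvOff : ∀ j a, ¬ (a ≤ m ∧ (j + a ≤ m ∨ (2 * a ≤ m ∧ j + a ≤ jl))) → j + m ≠ jl + a → vP j a = 0 ∧ vM j a = 0)
    (hvTop : ∀ j a, ¬ (a ≤ m ∧ (j + a ≤ m ∨ (2 * a ≤ m ∧ j + a ≤ jl))) → j + m = jl + a →
      (vP j a = if 2 * j + d ≤ 2 * jl + 1 ∧ (j + a + 2 ≤ m + 2 * d ∨ ε = 1) then (if j + a + 2 ≤ m + 2 * d then 1 else 2) * (q : ℚ) ^ (j - (j + a - m + 1) / 2) else 0) ∧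
      (vM j a = if 2 * j + d ≤ 2 * jl + 1 ∧ (j + a + 2 ≤ m + 2 * d ∨ ε = -1) then (if j + a + 2 ≤ m + 2 * d then 1 else 2) * (q : ℚ) ^ (j - (j + a - m + 1) / 2) else 0))
    (C : ℕ) (hC : jl ≤ C) :
    ε * ∑ j ∈ range (jl + 1), ∑ a ∈ range (jl + 2), (q : ℚ) ^ a * (if j + a ≤ C then vP j a - vM j a else 0) =
      (q : ℚ) ^ m * (2 * ∑ i ∈ range ((jl - d) / 2 + 1), (q : ℚ) ^ i - 2 * ∑ i ∈ range (d - d % 2), (q : ℚ) ^ i) -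
        2 * ∑ a ∈ (range (jl + 2)).filter (fun a => a ≤ m ∧ C + m < jl + 2 * a ∧ 2 * m + 2 * d < jl + 2 * a + 2 ∧ 2 * a + d ≤ 2 * m + 1), (q : ℚ) ^ (a + jl / 2) := by
  have hε' : ε = 1 ∨ ε = -1 := hε.imp_right And.left
  have hsplit : ∀ j a, (q : ℚ) ^ a * (if j + a ≤ C then vP j a - vM j a else 0) =
      (q : ℚ) ^ a * (vP j a - vM j a) - (q : ℚ) ^ a * (if C < j + a then vP j a - vM j a else 0) := fun j a => by
    by_cases h : j + a ≤ C
    · rw [if_pos h, if_neg (not_lt.2 h), mul_zero, sub_zero]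
    · rw [if_neg h, if_pos (not_le.1 h), mul_zero, sub_self]
  simp_rw [hsplit]
  simp only [Finset.sum_sub_distrib]
  rw [mul_sub, toricCensusSum_ramK q ε hq hd hjl hjlS hpar hmS hm hε nP nM vP vM hnP hnM hvGen hvOff hvTop,
    sum_cut_part_eq (q : ℚ) ε hε' hm hC vP vM hvOff hvTop]

/-! ## §4 The cut band as an interval -/

/-- **THE CUT BAND IS AN INTERVAL** once the far condition is implied (`m + 2d ≤ C + 2`, `m ≤ jl ≤ C`, `d ≥ 2`): the band of §2 is `a ∈ Ioc ((C + m − jl)∕2) ((2m + 1 − d)∕2)`.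
[cite: Flicker1998UnitaryFL, Prop. 7 p. 84] -/
theorem filter_band_eq_Ioc {d jl m C : ℕ} (hd : 2 ≤ d) (hm : m ≤ jl) (hC : jl ≤ C) (hfar : m + 2 * d ≤ C + 2) :
    (range (jl + 2)).filter (fun a => a ≤ m ∧ C + m < jl + 2 * a ∧ 2 * m + 2 * d < jl + 2 * a + 2 ∧ 2 * a + d ≤ 2 * m + 1) =
      Finset.Ioc ((C + m - jl) / 2) ((2 * m + 1 - d) / 2) := by
  ext a
  simp only [Finset.mem_filter, Finset.mem_range, Finset.mem_Ioc]
  omega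

/-- **(T5-P-coneΔ-R2)-RamK, INTERVAL FORM**: under `m + 2d ≤ C + 2` the cut weld reads `… = q^m·(2Σ_{i<(jl−d)∕2+1} q^i − 2Σ_{i<d−d%2} q^i) − 2·Σ_{a ∈ Ioc ((C+m−jl)∕2) ((2m+1−d)∕2)} q^{a + ⌊jl∕2⌋}`;
for `m + jl ≤ C` the interval is empty and ★ T5s is recovered (regime (R0)). [cite: Kottwitz1986BaseChangeUnits, §1 pp. 240–241] [cite: Flicker1998UnitaryFL, Prop. 7 p. 84] -/
theorem toricCensusSum_ramK_cut_Ioc (q : ℕ) {d jl m : ℕ} (ε : ℚ) (hq : 2 ≤ q) (hd : 2 ≤ d) (hjl : jl % 2 = d % 2) (hjlS : 3 * d ≤ jl + 2 + 2 * (d % 2))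
    (hpar : m % 2 = d % 2) (hmS : d - d % 2 ≤ m + 1) (hm : m ≤ jl) (hε : ε = 1 ∨ (ε = -1 ∧ jl + 2 ≤ m + 2 * d))
    (nP nM vP vM : ℕ → ℕ → ℚ)
    (hnP : ∀ j a, nP j a = ((if j = 0 then (if a = 0 then 1 else 0) else if j < a ∨ (j - a) % 2 = 1 then 0
      else if a = j then (if 2 ≤ d then q ^ j else (q - 1) * q ^ (j - 1)) else if a = 0 then (if 2 * d ≤ j + 1 then 2 else 1) * q ^ (j / 2)
      else if j - a + 2 < 2 * d then (q - 1) * q ^ (j - 1 - (j - a) / 2) else if j - a + 2 = 2 * d then (q - 2) * q ^ (j - d)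
      else 2 * (q - 1) * q ^ (j - 1 - (j - a) / 2) : ℕ) : ℚ))
    (hnM : ∀ j a, nM j a = ((if j = 0 then (if a = 0 then 1 else 0) else if j < a ∨ (j - a) % 2 = 1 then 0
      else if a = j then (if 2 ≤ d then q ^ j else (q + 1) * q ^ (j - 1)) else if a = 0 then (if j + 2 ≤ 2 * d then q ^ (j / 2) else 0)
      else if j - a + 2 < 2 * d then (q - 1) * q ^ (j - 1 - (j - a) / 2) else if j - a + 2 = 2 * d then q ^ (j - d + 1) else 0 : ℕ) : ℚ))
    (hvGen : ∀ j a, (a ≤ m ∧ (j + a ≤ m ∨ (2 * a ≤ m ∧ j + a ≤ jl))) → vP j a = nP j a ∧ vM j a = nM j a)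
    (hvOff : ∀ j a, ¬ (a ≤ m ∧ (j + a ≤ m ∨ (2 * a ≤ m ∧ j + a ≤ jl))) → j + m ≠ jl + a → vP j a = 0 ∧ vM j a = 0)
    (hvTop : ∀ j a, ¬ (a ≤ m ∧ (j + a ≤ m ∨ (2 * a ≤ m ∧ j + a ≤ jl))) → j + m = jl + a →
      (vP j a = if 2 * j + d ≤ 2 * jl + 1 ∧ (j + a + 2 ≤ m + 2 * d ∨ ε = 1) then (if j + a + 2 ≤ m + 2 * d then 1 else 2) * (q : ℚ) ^ (j - (j + a - m + 1) / 2) else 0) ∧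
      (vM j a = if 2 * j + d ≤ 2 * jl + 1 ∧ (j + a + 2 ≤ m + 2 * d ∨ ε = -1) then (if j + a + 2 ≤ m + 2 * d then 1 else 2) * (q : ℚ) ^ (j - (j + a - m + 1) / 2) else 0))
    (C : ℕ) (hC : jl ≤ C) (hfar : m + 2 * d ≤ C + 2) :
    ε * ∑ j ∈ range (jl + 1), ∑ a ∈ range (jl + 2), (q : ℚ) ^ a * (if j + a ≤ C then vP j a - vM j a else 0) =
      (q : ℚ) ^ m * (2 * ∑ i ∈ range ((jl - d) / 2 + 1), (q : ℚ) ^ i - 2 * ∑ i ∈ range (d - d % 2), (q : ℚ) ^ i) -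
        2 * ∑ a ∈ Finset.Ioc ((C + m - jl) / 2) ((2 * m + 1 - d) / 2), (q : ℚ) ^ (a + jl / 2) := by
  rw [toricCensusSum_ramK_cut q ε hq hd hjl hjlS hpar hmS hm hε nP nM vP vM hnP hnM hvGen hvOff hvTop C hC, filter_band_eq_Ioc hd hm hC hfar]

end Summit.HodgeConjecture.HodgeConjecture.Cruxes.H413.F0P3cDyRamToricCensusSumRamKCut
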